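import Summits.HodgeConjecture.HodgeConjecture.Theorems.Ring2WeilCoverageNormClassEq
import Summits.HodgeConjecture.HodgeConjecture.Theorems.Ring2WeilNormObstructionDescentCensus
import HarnessLib

/-!
# Weil-type family coverage — THEOREM S6 (product-window law), part D: base genus ONE — the three- and four-parameter `C₄ × S₃`
families of `(3,3)` Weil-type sixfolds on `W6.1.3 = (3, ℚ(i), [3])` (pub-hsemireg's row R3)

research route conditional on HC_CM; not a corollary; Q11.4-sentence-2 already refuted in dim ≥ 3.

Ring 2, WEIL-TYPE FAMILY-COVERAGE CENSUS (`## b04`, block b04.13 P.S. 3, owner ring2-b04, gen 49); fourth part of `Ring2WeilCoverageProductWindow`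
(same imports as part A).  THEOREM S6 holds for ANY base genus (`r₁ = g(D) − g(D/⟨c²⟩)` for the `ℤ/4`-curve `D = C̃/S₃`); over an
ELLIPTIC base the Hurwitz dimension is `N`, so the `C₄ × S₃`-curves `(1; c1:2, c1:2, c2:e)` (genus 25), `(1; c1:3, c1:e, c2:e)` (genus 27),
`(1; c1:2, c1:2, c2:3)` (genus 29) give THREE-parameter and `(1; c0:2, c1:2, c1:2, c2:2)` (genus 31), `(1; c0:2, c1:3, c1:e, c2:2)` (genus 33)
FOUR-parameter families whose hidden factor (`m = 6`, `(3,3)`, `r₁ = 3`) lies on the NON-split row `[3]` over `ℚ(i)`; the control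
`(1; c0:3, c2:e, c2:e)` (genus 21, `r₁ = 2`) is split.  Literal classes (engine `prodwin.py`, exact; local runs, each < 45 s) with the
CELL IDENTIFICATION `[det H] = [-3]`; the genus-25 datum's literal determinant `-16/27` coincides with part B's genus-23 `C₄ × S₃` datum
(`pwC4S3_c12_c12_c13_c2e_c33_q0_g23_mk_detH_ne_split` / `_eq_key` in `Ring2WeilCoverageProductWindowB`), which therefore serves for it verbatim.  (Motion / monodromy density of these families is NOT certified here.)
No `def`, no named fact, no `sorry`; nothing about Hodge classes; `HC_CM` used nowhere.  References: [cite: vanGeemen1994HodgeAV, (5.4.1), Lemma 5.2].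
-/

set_option linter.dupNamespace false

open Literature.AlgebraicGeometry.Motives
open Literature.AlgebraicGeometry.VanGeemen1994
open Summit.HodgeConjecture.HodgeConjecture.Ring2.Hypotheses

namespace Summit.HodgeConjecture.HodgeConjecture.Ring2.WeilCoverage

/-- `C₄ × S₃`-cover `(1; c0:3,c2:e,c2:e)` (genus 21, Hurwitz dimension 3; engine `prodwin.py`, exact): the HIDDEN FACTOR `B = V^{H₁×Stab(0)}` of the `(λ⊗ρ)`-piece `P ~ B^{2}` (census row of `P`: `W12.1.1`) — an abelian SIXFOLD with `(3,3)` `ℚ(√-1)`-action, WEIL TYPE — has literal `det H|_B = -64/9`, `a = 64/9`, `T(a) = []`: row `W6.1.1` (SPLIT); `r₁ = dim_K H¹(C̃/G₂)_λ = 2`. THEOREM S6 (product-window law, census b04.13 (A)) predicts `T(a_B) = []` from `r₁ = 2`, `r_H = 8` — CONFIRMED.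
research route conditional on HC_CM; not a corollary; Q11.4-sentence-2 already refuted in dim ≥ 3. [cite: vanGeemen1994HodgeAV, (5.4.1)] -/
theorem pwC4S3_c03_c2e_c2e_q1_g21_mk_detH_eq_split :
    (QuotientGroup.mk (Units.mk0 (((-64 : ℚ) / 9)) (by norm_num)) : weilNormResidueGroup 1) =
      splitDiscriminantClass 3 1 := by
  have e : Units.mk0 (((-64 : ℚ) / 9)) (by norm_num) = -(Units.mk0 ((64 : ℚ) / 9) (by norm_num)) := Units.ext (by norm_num)
  rw [e, mk_neg_eq_splitDiscriminantClass_iff_of_odd (n := 3) (by decide)]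
  exact mem_normUnitsSubgroup_of_sq_add_mul_sq _ ((8 : ℚ) / 3) (0 : ℚ) (by norm_num)

/-- `C₄ × S₃`-cover `(1; c1:3,c1:e,c2:e)` (genus 27, Hurwitz dimension 3; engine `prodwin.py`, exact): the HIDDEN FACTOR `B = V^{H₁×Stab(0)}` of the `(λ⊗ρ)`-piece `P ~ B^{2}` (census row of `P`: `W12.1.1`) — an abelian SIXFOLD with `(3,3)` `ℚ(√-1)`-action, WEIL TYPE — has literal `det H|_B = -8/27`, `a = 8/27`, `T(a) = [2, 3]`: row `W6.1.3` (NON-split); `r₁ = dim_K H¹(C̃/G₂)_λ = 3`. THEOREM S6 (product-window law, census b04.13 (A)) predicts `T(a_B) = [2, 3]` from `r₁ = 3`, `r_H = 9` — CONFIRMED.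
research route conditional on HC_CM; not a corollary; Q11.4-sentence-2 already refuted in dim ≥ 3. [cite: vanGeemen1994HodgeAV, (5.4.1)] -/
theorem pwC4S3_c13_c1e_c2e_q1_g27_mk_detH_ne_split :
    (QuotientGroup.mk (Units.mk0 (((-8 : ℚ) / 27)) (by norm_num)) : weilNormResidueGroup 1) ≠
      splitDiscriminantClass 3 1 := by
  have e : Units.mk0 (((-8 : ℚ) / 27)) (by norm_num) = -(Units.mk0 ((8 : ℚ) / 27) (by norm_num)) := Units.ext (by norm_num)
  rw [Ne, e, mk_neg_eq_splitDiscriminantClass_iff_of_odd (n := 3) (by decide)]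
  have h := mul_not_mem_normUnitsSubgroup (mem_normUnitsSubgroup_of_sq_add_mul_sq (d := 1) (a := ((8 : ℚ) / 81)) (by norm_num) ((2 : ℚ) / 9) ((2 : ℚ) / 9) (by norm_num))
    Summit.HodgeConjecture.Ring2WeilNormDescent.three_not_mem_norm_one
  rw [mk0_mul_mk0] at h
  norm_num at h
  exact h

/-- The same datum, CELL IDENTIFICATION: `[det H|_B] = [-3]` in `ℚˣ/Nm(ℚ(√-1)ˣ)` — the census ROW KEY of `W6.1.3` (`a·3 = ((8 : ℚ) / 9) = (((2 : ℚ) / 3))² + 1·(((2 : ℚ) / 3))²`).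
research route conditional on HC_CM; not a corollary; Q11.4-sentence-2 already refuted in dim ≥ 3. [cite: vanGeemen1994HodgeAV, Lemma 5.2 (3)] -/
theorem pwC4S3_c13_c1e_c2e_q1_g27_mk_detH_eq_key :
    (QuotientGroup.mk (Units.mk0 (-(((8 : ℚ) / 27))) (neg_ne_zero.2 (by norm_num))) : weilNormResidueGroup 1) =
      QuotientGroup.mk (Units.mk0 (-(3 : ℚ)) (neg_ne_zero.2 (by norm_num))) :=
  mk_neg_eq_mk_neg_of_mul_mem (by norm_num) (by norm_num)
    (mem_normUnitsSubgroup_of_sq_add_mul_sq _ ((2 : ℚ) / 3) ((2 : ℚ) / 3) (by norm_num))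

/-- `C₄ × S₃`-cover `(1; c0:2,c1:2,c1:2,c2:2)` (genus 31, Hurwitz dimension 4; engine `prodwin.py`, exact): the HIDDEN FACTOR `B = V^{H₁×Stab(0)}` of the `(λ⊗ρ)`-piece `P ~ B^{2}` (census row of `P`: `W12.1.1`) — an abelian SIXFOLD with `(3,3)` `ℚ(√-1)`-action, WEIL TYPE — has literal `det H|_B = -1/27`, `a = 1/27`, `T(a) = [2, 3]`: row `W6.1.3` (NON-split); `r₁ = dim_K H¹(C̃/G₂)_λ = 3`. THEOREM S6 (product-window law, census b04.13 (A)) predicts `T(a_B) = [2, 3]` from `r₁ = 3`, `r_H = 9` — CONFIRMED.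
research route conditional on HC_CM; not a corollary; Q11.4-sentence-2 already refuted in dim ≥ 3. [cite: vanGeemen1994HodgeAV, (5.4.1)] -/
theorem pwC4S3_c02_c12_c12_c22_q1_g31_mk_detH_ne_split :
    (QuotientGroup.mk (Units.mk0 (((-1 : ℚ) / 27)) (by norm_num)) : weilNormResidueGroup 1) ≠
      splitDiscriminantClass 3 1 := by
  have e : Units.mk0 (((-1 : ℚ) / 27)) (by norm_num) = -(Units.mk0 ((1 : ℚ) / 27) (by norm_num)) := Units.ext (by norm_num)
  rw [Ne, e, mk_neg_eq_splitDiscriminantClass_iff_of_odd (n := 3) (by decide)]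
  have h := mul_not_mem_normUnitsSubgroup (mem_normUnitsSubgroup_of_sq_add_mul_sq (d := 1) (a := ((1 : ℚ) / 81)) (by norm_num) ((1 : ℚ) / 9) (0 : ℚ) (by norm_num))
    Summit.HodgeConjecture.Ring2WeilNormDescent.three_not_mem_norm_one
  rw [mk0_mul_mk0] at h
  norm_num at h
  exact h

/-- The same datum, CELL IDENTIFICATION: `[det H|_B] = [-3]` in `ℚˣ/Nm(ℚ(√-1)ˣ)` — the census ROW KEY of `W6.1.3` (`a·3 = ((1 : ℚ) / 9) = (((1 : ℚ) / 3))² + 1·((0 : ℚ))²`).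
research route conditional on HC_CM; not a corollary; Q11.4-sentence-2 already refuted in dim ≥ 3. [cite: vanGeemen1994HodgeAV, Lemma 5.2 (3)] -/
theorem pwC4S3_c02_c12_c12_c22_q1_g31_mk_detH_eq_key :
    (QuotientGroup.mk (Units.mk0 (-(((1 : ℚ) / 27))) (neg_ne_zero.2 (by norm_num))) : weilNormResidueGroup 1) =
      QuotientGroup.mk (Units.mk0 (-(3 : ℚ)) (neg_ne_zero.2 (by norm_num))) :=
  mk_neg_eq_mk_neg_of_mul_mem (by norm_num) (by norm_num)
    (mem_normUnitsSubgroup_of_sq_add_mul_sq _ ((1 : ℚ) / 3) (0 : ℚ) (by norm_num))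

/-- `C₄ × S₃`-cover `(1; c0:2,c1:3,c1:e,c2:2)` (genus 33, Hurwitz dimension 4; engine `prodwin.py`, exact): the HIDDEN FACTOR `B = V^{H₁×Stab(0)}` of the `(λ⊗ρ)`-piece `P ~ B^{2}` (census row of `P`: `W12.1.1`) — an abelian SIXFOLD with `(3,3)` `ℚ(√-1)`-action, WEIL TYPE — has literal `det H|_B = -2/27`, `a = 2/27`, `T(a) = [2, 3]`: row `W6.1.3` (NON-split); `r₁ = dim_K H¹(C̃/G₂)_λ = 3`. THEOREM S6 (product-window law, census b04.13 (A)) predicts `T(a_B) = [2, 3]` from `r₁ = 3`, `r_H = 9` — CONFIRMED.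
research route conditional on HC_CM; not a corollary; Q11.4-sentence-2 already refuted in dim ≥ 3. [cite: vanGeemen1994HodgeAV, (5.4.1)] -/
theorem pwC4S3_c02_c13_c1e_c22_q1_g33_mk_detH_ne_split :
    (QuotientGroup.mk (Units.mk0 (((-2 : ℚ) / 27)) (by norm_num)) : weilNormResidueGroup 1) ≠
      splitDiscriminantClass 3 1 := by
  have e : Units.mk0 (((-2 : ℚ) / 27)) (by norm_num) = -(Units.mk0 ((2 : ℚ) / 27) (by norm_num)) := Units.ext (by norm_num)
  rw [Ne, e, mk_neg_eq_splitDiscriminantClass_iff_of_odd (n := 3) (by decide)]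
  have h := mul_not_mem_normUnitsSubgroup (mem_normUnitsSubgroup_of_sq_add_mul_sq (d := 1) (a := ((2 : ℚ) / 81)) (by norm_num) ((1 : ℚ) / 9) ((1 : ℚ) / 9) (by norm_num))
    Summit.HodgeConjecture.Ring2WeilNormDescent.three_not_mem_norm_one
  rw [mk0_mul_mk0] at h
  norm_num at h
  exact h

/-- The same datum, CELL IDENTIFICATION: `[det H|_B] = [-3]` in `ℚˣ/Nm(ℚ(√-1)ˣ)` — the census ROW KEY of `W6.1.3` (`a·3 = ((2 : ℚ) / 9) = (((1 : ℚ) / 3))² + 1·(((1 : ℚ) / 3))²`).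
research route conditional on HC_CM; not a corollary; Q11.4-sentence-2 already refuted in dim ≥ 3. [cite: vanGeemen1994HodgeAV, Lemma 5.2 (3)] -/
theorem pwC4S3_c02_c13_c1e_c22_q1_g33_mk_detH_eq_key :
    (QuotientGroup.mk (Units.mk0 (-(((2 : ℚ) / 27))) (neg_ne_zero.2 (by norm_num))) : weilNormResidueGroup 1) =
      QuotientGroup.mk (Units.mk0 (-(3 : ℚ)) (neg_ne_zero.2 (by norm_num))) :=
  mk_neg_eq_mk_neg_of_mul_mem (by norm_num) (by norm_num)
    (mem_normUnitsSubgroup_of_sq_add_mul_sq _ ((1 : ℚ) / 3) ((1 : ℚ) / 3) (by norm_num))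

/-- `C₄ × S₃`-cover `(1; c1:2,c1:2,c2:3)` (genus 29, Hurwitz dimension 3; engine `prodwin.py`, exact): the HIDDEN FACTOR `B = V^{H₁×Stab(0)}` of the `(λ⊗ρ)`-piece `P ~ B^{2}` (census row of `P`: `W12.1.1`) — an abelian SIXFOLD with `(3,3)` `ℚ(√-1)`-action, WEIL TYPE — has literal `det H|_B = -8/27`, `a = 8/27`, `T(a) = [2, 3]`: row `W6.1.3` (NON-split); `r₁ = dim_K H¹(C̃/G₂)_λ = 3`. THEOREM S6 (product-window law, census b04.13 (A)) predicts `T(a_B) = [2, 3]` from `r₁ = 3`, `r_H = 9` — CONFIRMED.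
research route conditional on HC_CM; not a corollary; Q11.4-sentence-2 already refuted in dim ≥ 3. [cite: vanGeemen1994HodgeAV, (5.4.1)] -/
theorem pwC4S3_c12_c12_c23_q1_g29_mk_detH_ne_split :
    (QuotientGroup.mk (Units.mk0 (((-8 : ℚ) / 27)) (by norm_num)) : weilNormResidueGroup 1) ≠
      splitDiscriminantClass 3 1 := by
  have e : Units.mk0 (((-8 : ℚ) / 27)) (by norm_num) = -(Units.mk0 ((8 : ℚ) / 27) (by norm_num)) := Units.ext (by norm_num)
  rw [Ne, e, mk_neg_eq_splitDiscriminantClass_iff_of_odd (n := 3) (by decide)]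
  have h := mul_not_mem_normUnitsSubgroup (mem_normUnitsSubgroup_of_sq_add_mul_sq (d := 1) (a := ((8 : ℚ) / 81)) (by norm_num) ((2 : ℚ) / 9) ((2 : ℚ) / 9) (by norm_num))
    Summit.HodgeConjecture.Ring2WeilNormDescent.three_not_mem_norm_one
  rw [mk0_mul_mk0] at h
  norm_num at h
  exact h

/-- The same datum, CELL IDENTIFICATION: `[det H|_B] = [-3]` in `ℚˣ/Nm(ℚ(√-1)ˣ)` — the census ROW KEY of `W6.1.3` (`a·3 = ((8 : ℚ) / 9) = (((2 : ℚ) / 3))² + 1·(((2 : ℚ) / 3))²`).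
research route conditional on HC_CM; not a corollary; Q11.4-sentence-2 already refuted in dim ≥ 3. [cite: vanGeemen1994HodgeAV, Lemma 5.2 (3)] -/
theorem pwC4S3_c12_c12_c23_q1_g29_mk_detH_eq_key :
    (QuotientGroup.mk (Units.mk0 (-(((8 : ℚ) / 27))) (neg_ne_zero.2 (by norm_num))) : weilNormResidueGroup 1) =
      QuotientGroup.mk (Units.mk0 (-(3 : ℚ)) (neg_ne_zero.2 (by norm_num))) :=
  mk_neg_eq_mk_neg_of_mul_mem (by norm_num) (by norm_num)
    (mem_normUnitsSubgroup_of_sq_add_mul_sq _ ((2 : ℚ) / 3) ((2 : ℚ) / 3) (by norm_num))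

end Summit.HodgeConjecture.HodgeConjecture.Ring2.WeilCoverage
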